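import Summits.QuantumFields.QCD.Theses.PauliWegnerSea

/-!
# Crux `GluonicCompletion` (stmt-QuantumFields-9152), line `finite-sign-budget-at-the-scheme-volume` — stub `stub_haarCurveStep`

Right-invariant averaging along a curve (one step; pure measure theory): for a finite right-invariant
Borel measure `μ` on a topological group `G`, a continuous curve `c : ℝ → G` and a closed set `Z` such that
every right `c`-orbit `θ ↦ g·c(θ)` lies in `Z` identically or meets it in a Lebesgue-null set of parameters,
`μ(Z) = μ{g | ∀ θ, g·c(θ) ∈ Z}`.

Proof.  Let `ν` be Lebesgue measure restricted to `[0,1]` (total mass `1`) and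
`S = {(g,θ) | g·c(θ) ∈ Z} ⊆ G × ℝ`; `S` is closed, hence Borel for the product σ-algebra (`ℝ` is second
countable).  Computing `(μ ⊗ ν)(S)` by the two iterated formulas (`Measure.prod_apply_symm`,
`Measure.prod_apply`): the `θ`-sections are the right translates `Z·c(θ)⁻¹`, of `μ`-measure `μ(Z)` by
right invariance, so `(μ ⊗ ν)(S) = μ(Z)`; the `g`-sections have `ν`-measure `1` if the orbit lies in `Z`
and `0` if it meets `Z` in a Lebesgue-null set, so `(μ ⊗ ν)(S) = μ{g | ∀ θ, g·c(θ) ∈ Z}`.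
-/

noncomputable section

namespace Summit.QuantumFields.QCD.Theorems.FiniteSignBudgetAtTheSchemeVolume

open scoped BigOperators Topology ENNReal
open MeasureTheory Filter

/-- **Sections of the averaging set have measure `0` or `1`.**  For the restricted Lebesgue measure
`ν = vol|[0,1]` and a point `g` whose orbit `θ ↦ g·c(θ)` lies in `Z` identically or meets it in a
Lebesgue-null set, `ν {θ | g·c(θ) ∈ Z}` is the indicator of `{g | ∀ θ, g·c(θ) ∈ Z}` at `g` (the two
branches are exclusive since `vol ℝ = ∞ ≠ 0`). [folklore] -/
private theorem restrict_volume_section_eq_indicator {G : Type} [Group G] (c : ℝ → G) (Z : Set G) (g : G)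
    (hg : (∀ θ : ℝ, g * c θ ∈ Z) ∨ volume {θ : ℝ | g * c θ ∈ Z} = 0) :
    (volume.restrict (Set.Icc (0 : ℝ) 1)) {θ : ℝ | g * c θ ∈ Z} =
      {g : G | ∀ θ : ℝ, g * c θ ∈ Z}.indicator 1 g := by
  rcases hg with h | h
  · have hmem : g ∈ {g : G | ∀ θ : ℝ, g * c θ ∈ Z} := h
    rw [Set.indicator_of_mem hmem, Pi.one_apply, Set.eq_univ_of_forall (s := {θ : ℝ | g * c θ ∈ Z}) h,
      Measure.restrict_apply_univ, Real.volume_Icc, sub_zero, ENNReal.ofReal_one]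
  · have hnmem : g ∉ {g : G | ∀ θ : ℝ, g * c θ ∈ Z} := by
      intro hall
      rw [Set.mem_setOf_eq] at hall
      rw [Set.eq_univ_of_forall (s := {θ : ℝ | g * c θ ∈ Z}) hall, Real.volume_univ] at h
      exact ENNReal.top_ne_zero h
    rw [Set.indicator_of_notMem hnmem]
    exact nonpos_iff_eq_zero.mp ((Measure.restrict_apply_le _ _).trans h.le)

/-- **`stub_haarCurveStep` — right-invariant averaging along a curve (one step).** For a finite
right-invariant Borel measure `μ` on a topological group `G`, a continuous curve `c : ℝ → G` and a closed set
`Z` such that every right `c`-orbit `θ ↦ g·c(θ)` lies in `Z` identically or meets it in a Lebesgue-null set of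
parameters, `μ(Z) = μ{g | ∀ θ, g·c(θ) ∈ Z}`.  Proof: with `ν = vol|[0,1]` and the closed set
`S = {(g,θ) | g·c(θ) ∈ Z}`, `(μ ⊗ ν)(S) = ∫ μ(Z·c(θ)⁻¹) dν(θ) = μ(Z)` (right invariance,
`Measure.prod_apply_symm`) and `(μ ⊗ ν)(S) = ∫ ν{θ | g·c(θ) ∈ Z} dμ(g) = μ{g | ∀ θ, g·c(θ) ∈ Z}`
(`Measure.prod_apply`, the inner measure being the indicator of the latter set). [folklore] -/
theorem stub_haarCurveStep :
    ∀ (G : Type) [Group G] [TopologicalSpace G] [IsTopologicalGroup G] [MeasurableSpace G] [BorelSpace G]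
      (μ : Measure G) [IsFiniteMeasure μ] [μ.IsMulRightInvariant] (c : ℝ → G), Continuous c →
      ∀ Z : Set G, IsClosed Z →
        (∀ g : G, (∀ θ : ℝ, g * c θ ∈ Z) ∨ volume {θ : ℝ | g * c θ ∈ Z} = 0) →
          μ Z = μ {g : G | ∀ θ : ℝ, g * c θ ∈ Z} := by
  intro G _ _ _ _ _ μ _ _ c hc Z hZ hdich
  -- the averaging set and its measurability (`ℝ` is second countable, so closed sets of `G × ℝ` are Borel)
  have hS : MeasurableSet {p : G × ℝ | p.1 * c p.2 ∈ Z} :=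
    (hZ.preimage (continuous_fst.mul (hc.comp continuous_snd))).measurableSet
  -- the averaged set is closed, hence measurable
  have hZ' : MeasurableSet {g : G | ∀ θ : ℝ, g * c θ ∈ Z} := by
    rw [Set.setOf_forall]
    exact (isClosed_iInter fun θ => hZ.preimage (continuous_id.mul continuous_const)).measurableSet
  -- first computation: `θ`-sections are right translates of `Z`
  have h1 : (μ.prod (volume.restrict (Set.Icc (0 : ℝ) 1))) {p : G × ℝ | p.1 * c p.2 ∈ Z} = μ Z := by
    rw [Measure.prod_apply_symm hS]
    have hθ : ∀ θ : ℝ, μ ((fun g : G => (g, θ)) ⁻¹' {p : G × ℝ | p.1 * c p.2 ∈ Z}) = μ Z := fun θ =>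
      measure_preimage_mul_right μ (c θ) Z
    simp_rw [hθ, lintegral_const, Measure.restrict_apply_univ, Real.volume_Icc, sub_zero,
      ENNReal.ofReal_one, mul_one]
  -- second computation: `g`-sections have measure `0` or `1`
  have h2 : (μ.prod (volume.restrict (Set.Icc (0 : ℝ) 1))) {p : G × ℝ | p.1 * c p.2 ∈ Z} =
      μ {g : G | ∀ θ : ℝ, g * c θ ∈ Z} := by
    rw [Measure.prod_apply hS, ← lintegral_indicator_one hZ']
    refine lintegral_congr fun g => ?_
    exact restrict_volume_section_eq_indicator c Z g (hdich g)
  rw [← h1, h2]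

end Summit.QuantumFields.QCD.Theorems.FiniteSignBudgetAtTheSchemeVolume

end
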